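import Summits.CriticalPhenomena.PercolationContinuityZ3.Theorems.PercNearOneGluingNoHeavyPcintMemUniformTenDataA
import Summits.CriticalPhenomena.PercolationContinuityZ3.Theorems.PercNearOneGluingNoHeavyPcintMemUniformTenDataB
import Summits.CriticalPhenomena.PercolationContinuityZ3.Theorems.PercNearOneGluingNoHeavyPcintMemUniformTenDataC
import Summits.CriticalPhenomena.PercolationContinuityZ3.Theorems.PercNearOneGluingNoHeavyPcintMemUniformTenDataD
import Summits.CriticalPhenomena.PercolationContinuityZ3.Theorems.PercNearOneGluingNoHeavyPcintMemUniformTenDataE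
import Summits.CriticalPhenomena.PercolationContinuityZ3.Theorems.PercNearOneGluingNoHeavyPcintMemUniformTenDataF
import Summits.CriticalPhenomena.PercolationContinuityZ3.Theorems.PercNearOneGluingNoHeavyPcintMemUniformTenDataG
import Summits.CriticalPhenomena.PercolationContinuityZ3.Theorems.PercNearOneGluingNoHeavyPcintMemUniformTenDataH
import Summits.CriticalPhenomena.PercolationContinuityZ3.Theorems.PercNearOneGluingNoHeavyPcintMemUniformChunkFast
import HarnessLib

/-!
# CriticalPhenomena/PercolationContinuityZ3 — Theorems/PercNearOneGluingNoHeavyPcintMemUniformTenData.lean: the assembled 6192-row memory-10 table `u10tab` (97 chunks) and its cheap invariants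

Lane prim-pcint, STRUCTURE rule (prim-pcint-2 GEN 19).  `u10tab = [u10c_0, …, u10c_96]` (…TenDataA–H), `chunksOK_u10` (chunk discipline),
`length_u10` (`(rowsOf perm6 u10tab).length = 6192`), `sstC_u10_zero` (row `0` is `∅`), and `permsOK_perm6` (the 720 transposition products of
…TenDataA agree with the Lehmer decoding used by the fast structural check of …MemUniformChunkFast).  All by `decide +kernel`.

HONEST FRAMING: data assembly and finite checks.  No `sorry`; standard axioms.  Written by prim-pcint-2 gen 19, 2026-08-26.
-/

namespace Summit.CriticalPhenomena.PercolationContinuityZ3.Theorems.Pcint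

open Literature.Probability.Percolation Literature.Probability.LatticeModels

/-- **The 6192-row memory-10 list in base dimension 6** (97 chunks of ≤ 64 encoded rows). [folklore] -/
def u10tab : List (List (List ℕ × List ℕ)) :=
  [u10c_0, u10c_1, u10c_2, u10c_3, u10c_4, u10c_5, u10c_6, u10c_7, u10c_8, u10c_9, u10c_10, u10c_11, u10c_12, u10c_13, u10c_14, u10c_15, u10c_16, u10c_17, u10c_18, u10c_19, u10c_20, u10c_21, u10c_22, u10c_23, u10c_24, u10c_25, u10c_26, u10c_27, u10c_28, u10c_29, u10c_30, u10c_31, u10c_32, u10c_33, u10c_34, u10c_35, u10c_36, u10c_37, u10c_38, u10c_39, u10c_40, u10c_41, u10c_42, u10c_43, u10c_44, u10c_45, u10c_46, u10c_47, u10c_48, u10c_49, u10c_50, u10c_51, u10c_52, u10c_53, u10c_54, u10c_55, u10c_56, u10c_57, u10c_58, u10c_59, u10c_60, u10c_61, u10c_62, u10c_63, u10c_64, u10c_65, u10c_66, u10c_67, u10c_68, u10c_69, u10c_70, u10c_71, u10c_72, u10c_73, u10c_74, u10c_75, u10c_76, u10c_77, u10c_78, u10c_79, u10c_80, u10c_81,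 u10c_82, u10c_83, u10c_84, u10c_85, u10c_86, u10c_87, u10c_88, u10c_89, u10c_90, u10c_91, u10c_92, u10c_93, u10c_94, u10c_95, u10c_96]

/-- Chunk discipline of `u10tab`. [folklore] -/
theorem chunksOK_u10 : ChunksOK u10tab = true := by
  decide +kernel

/-- `u10tab` decodes to 6192 rows. [folklore] -/
theorem length_u10 : (rowsOf perm6 u10tab).length = 6192 := by
  rw [length_rowsOf]; decide +kernel

/-- Row `0` of `u10tab` is the empty state. [folklore] -/
theorem sstC_u10_zero : sstC u10tab 0 = ∅ := by
  decide +kernel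

/-- The permutation table `perm6` agrees with the Lehmer decoding. [folklore] -/
theorem permsOK_perm6 : PermsOK perm6 := by
  unfold PermsOK; decide +kernel

end Summit.CriticalPhenomena.PercolationContinuityZ3.Theorems.Pcint
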